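import Mathlib
import Summits.Ventures.PercRepro2.Defs
import Summits.Ventures.PercRepro2.Harris
import Summits.Ventures.PercRepro2.Graph
import Summits.Ventures.PercRepro2.Events
import Summits.Ventures.PercRepro2.Induced
import Summits.Ventures.PercRepro2.BHK
import Summits.Ventures.PercRepro2.BHKEvents
import Summits.Ventures.PercRepro2.VdBKahn
import Summits.Ventures.PercRepro2.BHKAvoid

/-!
# The free-`v`, `y ∈ C₁` lean dominates the avoided lean: `FreeYLean.free_y_lean`
(blind cell PercRepro2, mine-c g30; `conjectures/MINE-C.md` §39.9)

Roots `a₁, a₂`, a mark `b`, vertices `v, y`; `N = {a₁ ↮ {a₂, v}}` (the world `ν(· | v ∉ C₁)`).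
Conditioning the avoided world `N` further on `y ∈ C₁` AND `v ∉ C₂` (the status class `(0,1)`:
`v` free, `y` on `a₁`'s side) does not lower the probability of `b ∈ C₁`:

  `P(b ∈ C₁, N) · P(y ∈ C₁, v ∉ C₂, N) ≤ P(b ∈ C₁, y ∈ C₁, v ∉ C₂, N) · P(N)`,

i.e. `ν(b ∈ C₁ | v ∉ U, y ∈ C₁) ≥ ν(b ∈ C₁ | v ∉ C₁)` — the sub-lemma `L1` of (SUFF-1) (`MINE-C.md`
§39.9), the "(0,1)-class excess".  Proof: explore `C₁ = K`; on `N` the cluster of `a₂` is its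
cluster in `G ∖ K`, so `v ∉ C₂` has conditional probability `1 − g(K)` with `g = delClusterProb`
(antitone); `K ↦ 1[y ∈ K]·(1 − g(K))` and `K ↦ 1[b ∈ K]` are both monotone and non-negative, and
the law of `C₁` given `a₁ ↮ {a₂, v}` is positively associated (`bhk_induced`, BHK06 Thm 1.3).
The point: the extra condition `v ∉ C₂` is an INCREASING tilt of the `C₁`-law, harmless for this
one covariance even though it can break positive association in general (§38.3, ROOT3).
-/

namespace Summit.Ventures.PercRepro2

namespace FreeYLean

variable {V : Type*} {E : Type*} [Fintype E] [DecidableEq E] [Fintype V] [DecidableEq V]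
  {R : Type*} [Field R] [LinearOrder R] [IsStrictOrderedRing R]

/-- **The free-`y` lean inequality** (cluster-event form): with `N = {a₁ ↮ X}`, `a₂ ∈ X`, for
up-sets `𝓤 ∋ b`-type and `𝓨`, `P(C₁ ∈ 𝓤, N) · (P(C₁ ∈ 𝓨, N) − P(C₁ ∈ 𝓨, C₂ ∈ 𝓥, N)) ≤
(P(C₁ ∈ 𝓤 ∩ 𝓨, N) − P(C₁ ∈ 𝓤 ∩ 𝓨, C₂ ∈ 𝓥, N)) · P(N)` for every up-set `𝓥` of `C₂`. -/
theorem free_y_lean_general (p : E → R) (hp : IsProbVec p) (ends : E → Sym2 V) (a₁ a₂ : V)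
    {X : Finset V} (ha₂ : a₂ ∈ X) {𝓤 𝓨 𝓥 : Set (Set V)} (h𝓤 : IsUpperSet 𝓤) (h𝓨 : IsUpperSet 𝓨)
    (h𝓥 : IsUpperSet 𝓥) :
    prob p (clusterInEvent ends a₁ 𝓤 ∩ avoidAll ends a₁ X) *
        (prob p (clusterInEvent ends a₁ 𝓨 ∩ avoidAll ends a₁ X) -
          prob p (clusterInEvent ends a₁ 𝓨 ∩ clusterInEvent ends a₂ 𝓥 ∩ avoidAll ends a₁ X)) ≤
      (prob p (clusterInEvent ends a₁ (𝓤 ∩ 𝓨) ∩ avoidAll ends a₁ X) -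
          prob p (clusterInEvent ends a₁ (𝓤 ∩ 𝓨) ∩ clusterInEvent ends a₂ 𝓥 ∩
            avoidAll ends a₁ X)) *
        prob p (avoidAll ends a₁ X) := by
  classical
  set g := delClusterProb p ends a₂ 𝓥 with hg
  have hg_anti : Antitone g := delClusterProb_anti p hp ends a₂ h𝓥
  have hg1 : ∀ W, g W ≤ 1 := delClusterProb_le_one p hp ends a₂ 𝓥
  have hg0 : ∀ W, 0 ≤ g W := delClusterProb_nonneg p hp ends a₂ 𝓥
  have hF₁ : Monotone (𝓤.indicator (1 : Set V → R)) := monotone_indicator_one_of_isUpperSet h𝓤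
  have hFy : Monotone (𝓨.indicator (1 : Set V → R)) := monotone_indicator_one_of_isUpperSet h𝓨
  have hF₁0 : ∀ W, 0 ≤ 𝓤.indicator (1 : Set V → R) W :=
    fun W => Set.indicator_apply_nonneg fun _ => zero_le_one
  have hFy0 : ∀ W, 0 ≤ 𝓨.indicator (1 : Set V → R) W :=
    fun W => Set.indicator_apply_nonneg fun _ => zero_le_one
  have hF₂ : Monotone (fun W => 𝓨.indicator (1 : Set V → R) W * (1 - g W)) := by
    intro W W' h
    simp only
    have h1 : 𝓨.indicator (1 : Set V → R) W ≤ 𝓨.indicator 1 W' := hFy h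
    have h2 : 1 - g W ≤ 1 - g W' := by linarith [hg_anti h]
    have h3 : 0 ≤ 1 - g W := by linarith [hg1 W]
    exact mul_le_mul h1 h2 h3 (hFy0 W')
  have hF₂0 : ∀ W, 0 ≤ 𝓨.indicator (1 : Set V → R) W * (1 - g W) :=
    fun W => mul_nonneg (hFy0 W) (by linarith [hg1 W])
  have key := bhk_induced p hp ends a₁ hF₁ hF₂ hF₁0 hF₂0 Finset.univ X X (Finset.subset_univ _)
    (Finset.subset_univ _)
  simp only [Finset.inter_self, Finset.union_self, REvent_univ] at key
  have e : ∀ F : Set V → R, clusterObs ends Finset.univ a₁ F * (avoidAll ends a₁ X).indicator 1 =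
      fun ω => F (cluster ends ω a₁) * (avoidAll ends a₁ X).indicator 1 ω := by
    intro F
    funext ω
    simp only [Pi.mul_apply, clusterObs_apply, clusterIn_univ]
  rw [e, e, e] at key
  simp only [Pi.mul_apply] at key
  -- the three expectations
  have eU : expect p (fun ω => 𝓤.indicator 1 (cluster ends ω a₁) *
      (avoidAll ends a₁ X).indicator 1 ω) =
      prob p (clusterInEvent ends a₁ 𝓤 ∩ avoidAll ends a₁ X) :=
    (prob_clusterInEvent_inter_eq_expect p ends a₁ 𝓤 _).symm
  have eY : expect p (fun ω => 𝓨.indicator 1 (cluster ends ω a₁) *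
      (avoidAll ends a₁ X).indicator 1 ω) =
      prob p (clusterInEvent ends a₁ 𝓨 ∩ avoidAll ends a₁ X) :=
    (prob_clusterInEvent_inter_eq_expect p ends a₁ 𝓨 _).symm
  have eYV := prob_clusterIn_inter_avoid_eq_expect p ends a₁ a₂ ha₂ 𝓨 𝓥
  have eUY : expect p (fun ω => (𝓤 ∩ 𝓨).indicator 1 (cluster ends ω a₁) *
      (avoidAll ends a₁ X).indicator 1 ω) =
      prob p (clusterInEvent ends a₁ (𝓤 ∩ 𝓨) ∩ avoidAll ends a₁ X) :=
    (prob_clusterInEvent_inter_eq_expect p ends a₁ (𝓤 ∩ 𝓨) _).symm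
  have eUYV := prob_clusterIn_inter_avoid_eq_expect p ends a₁ a₂ ha₂ (𝓤 ∩ 𝓨) 𝓥
  have e2 : expect p (fun ω => 𝓨.indicator 1 (cluster ends ω a₁) * (1 - g (cluster ends ω a₁)) *
      (avoidAll ends a₁ X).indicator 1 ω) =
      prob p (clusterInEvent ends a₁ 𝓨 ∩ avoidAll ends a₁ X) -
        prob p (clusterInEvent ends a₁ 𝓨 ∩ clusterInEvent ends a₂ 𝓥 ∩ avoidAll ends a₁ X) := by
    rw [eYV, ← eY, ← expect_sub]
    congr 1
    funext ω
    simp only [Pi.sub_apply]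
    ring
  have hind : ∀ W : Set V, 𝓤.indicator (1 : Set V → R) W * 𝓨.indicator 1 W =
      (𝓤 ∩ 𝓨).indicator 1 W := by
    intro W
    by_cases h1 : W ∈ 𝓤 <;> by_cases h2 : W ∈ 𝓨 <;> simp [h1, h2]
  have e3 : expect p (fun ω => 𝓤.indicator 1 (cluster ends ω a₁) *
      (𝓨.indicator 1 (cluster ends ω a₁) * (1 - g (cluster ends ω a₁))) *
      (avoidAll ends a₁ X).indicator 1 ω) =
      prob p (clusterInEvent ends a₁ (𝓤 ∩ 𝓨) ∩ avoidAll ends a₁ X) -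
        prob p (clusterInEvent ends a₁ (𝓤 ∩ 𝓨) ∩ clusterInEvent ends a₂ 𝓥 ∩
          avoidAll ends a₁ X) := by
    rw [eUYV, ← eUY, ← expect_sub]
    congr 1
    funext ω
    simp only [Pi.sub_apply]
    rw [← hind]
    ring
  rw [eU, e2, e3] at key
  exact key

omit [Fintype E] [DecidableEq E] [Fintype V] [DecidableEq V] in
/-- `{C(a₁) ∈ {K | z ∈ K}} = {a₁ ↔ z}`. -/
lemma clusterInEvent_mem (ends : E → Sym2 V) (a₁ z : V) :
    clusterInEvent ends a₁ {K : Set V | z ∈ K} = connEvent ends a₁ z := by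
  ext ω; simp only [mem_clusterInEvent, Set.mem_setOf_eq, mem_cluster, mem_connEvent]

/-- **L1 (the (0,1)-class excess)**: with `N = {a₁ ↮ {a₂, v}}`,
`P(a₁↔b, N) · (P(a₁↔y, N) − P(a₁↔y, a₂↔v, N)) ≤ (P(a₁↔b, a₁↔y, N) − P(a₁↔b, a₁↔y, a₂↔v, N)) · P(N)`,
i.e. `ν(b ∈ C₁ | v ∉ C₁ ∪ C₂, y ∈ C₁) ≥ ν(b ∈ C₁ | v ∉ C₁)`. -/
theorem free_y_lean (p : E → R) (hp : IsProbVec p) (ends : E → Sym2 V) (a₁ a₂ b v y : V) :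
    prob p (connEvent ends a₁ b ∩ avoidAll ends a₁ {a₂, v}) *
        (prob p (connEvent ends a₁ y ∩ avoidAll ends a₁ {a₂, v}) -
          prob p (connEvent ends a₁ y ∩ connEvent ends a₂ v ∩ avoidAll ends a₁ {a₂, v})) ≤
      (prob p (connEvent ends a₁ b ∩ connEvent ends a₁ y ∩ avoidAll ends a₁ {a₂, v}) -
          prob p (connEvent ends a₁ b ∩ connEvent ends a₁ y ∩ connEvent ends a₂ v ∩
            avoidAll ends a₁ {a₂, v})) *
        prob p (avoidAll ends a₁ {a₂, v}) := by
  have hU : IsUpperSet {K : Set V | b ∈ K} := fun _ _ hST h => hST h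
  have hY : IsUpperSet {K : Set V | y ∈ K} := fun _ _ hST h => hST h
  have hV : IsUpperSet {L : Set V | v ∈ L} := fun _ _ hST h => hST h
  have key := free_y_lean_general p hp ends a₁ a₂ (X := {a₂, v}) (Finset.mem_insert_self a₂ {v})
    hU hY hV
  have eUY : clusterInEvent ends a₁ ({K : Set V | b ∈ K} ∩ {K : Set V | y ∈ K}) =
      connEvent ends a₁ b ∩ connEvent ends a₁ y := by
    ext ω
    simp only [mem_clusterInEvent, Set.mem_inter_iff, Set.mem_setOf_eq, mem_cluster, mem_connEvent]
  rw [clusterInEvent_mem, clusterInEvent_mem, clusterInEvent_mem, eUY] at key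
  exact key

end FreeYLean

end Summit.Ventures.PercRepro2
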